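/-
Copyright (c) 2026 the pub-hodgecm-mathlib formalisation cell (harness21).  Prover seat hodgecm-mathlib-R90-C10-p08 (g3), R90-TF SLAB section S1 «Ch10-local» (base
R90-C10), h413 = `stmt-HodgeConjecture-24833`; line «U4Keys :182 — THE WILD CORNER (S-W)», brick (W-2) «THE UNIT-NORM INDEX» (dealer R90-C10-plan (g3) card 03:17:00Z,
GO R-S1-37 03:22:41Z; census `R90/R90-C10-p08/g3/CENSUS-W2.v1.md` debdfee2106b61f7; p02 (g3) census f6499a1e §6 (W-2); K2E3-p34 (g3) census (c)).  2026-09-05.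
-/
import Summits.HodgeConjecture.HodgeConjecture.Theorems.R90S1QuadraticCharOfNormTrivial   -- ★ p05 (g0): the full-group transport template; brings ★ `LocalFieldInvolutionNorm.norm_dichotomy_of_not_norm`, ★ `isUnit_iff_ne_zero_localRing`, ★ `LocalRing.eq_iff_apply_eq`, ★ `exists_conjLocal_skew_unit`, the local-field instances of `L_w`
import Summits.HodgeConjecture.HodgeConjecture.Theorems.F0P3cDyRamWildPlaceDatum            -- ★ LH4-p02 (g12): `exists_isRamifiedQuadraticDatum_of_placesOver` (the datum at a ramified CM place); brings ★ `galAdicCompletionMap_galAdicCompletionMap_of_smul_eq`, ★ `valued_galAdicCompletionMap`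
import Literature.NumberTheory.Automorphic.HeisenbergWildSkewNormClassHalving                -- ★ LH4-p10 (g5): `UnitaryGroup.exists_unit_fixed_nonnorm` (a `σ`-fixed non-norm unit of `R`, index-two dichotomy); brings ★ `WildQuadraticDatum.*` (`NormSignConductor`, `NonNormUnit`, `Trace`), ★ `isAdicComplete_valuedInteger_of_completeSpace`, ★ `finite_residueField_adicCompletion`, ★ `exists_unit_valued_apply_eq_exp_neg_one`
import HarnessLib

/-!
# R90-TF S1 «Ch10-local» ∕ U4Keys :182, THE WILD CORNER — brick (W-2): on the `σ`-fixed units of modulus one, a character `χ₁` of `Rˣ` killing the unit norms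
# `u·σu` (`hB`) and non-trivial there (`hFε`) IS the norm-class sign `ω = normSign σ_w`; the unit-norm index `[U_F : N U_E]` is EXACTLY two at a ramified place,
# and `χ₁|_{U_F}` has conductor `d` (the different exponent) — Serre, *Corps locaux* V §3 Cor. 3, XV §2, in the `χ₁ : Rˣ →* ℂˣ` currency of the S1 determinant road

Cell `pub/hodgecm-mathlib`, crux H413 = `stmt-HodgeConjecture-24833`, route of record `HCCMUnconditional` (no route verbs); lane `--supports stmt-HodgeConjecture-24833 --as helper`,
count-neutral.  THEOREMS ONLY (no `def`, no `instance`, no `notation`, no named-fact hypothesis, no `sorry`); ★-only imports.  NOT THE PAYER of :182 ∕ (S-W).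

FRAME.  `L` CM, `v` a finite place of `L⁺`, `w ∣ v` with `c • w = w` (NON-SPLIT: one place, `R := LocalRing L v = Π_{w′∣v} L_{w′} ≅ L_w ⊃ F_v`), `σ := conjLocal` (`= σ_w :=
galAdicCompletionMap c hw` read at `w`, ★ `conjLocal_apply_eq_of_smul_eq`), `U_F :=` the `σ`-fixed units of `R` of modulus one (`Units.map σ s = s ∧ ∀ w′, |s_{w′}| = 1`),
`N y := σy·y`.  The letters `(hB)` («`χ₁(u·σu) = 1` for every unit `u` of modulus one») and `(hFε)` («some `a₀ ∈ U_F` has `χ₁ a₀ ≠ 1`» — sub-branch (R-b)) are BYTE-IDENTICAL to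
★ (7a) `R90S1BposRamConversion` :62–65.

WHAT IS PROVED (everything the FOUR-FRAME squad's ★ one-field toolkit `WildQuadraticDatum.*` ∕ ★ `LocalFieldInvolutionNorm.*` says, TRANSPORTED to `Rˣ` and `χ₁`):
* §1 TRANSPORT KIT: `valued_apply_eq_one_of_norm_eq` (`σy·y = s`, `s ∈ U_F` ⇒ `|y_{w′}| = 1`) and the one-place lift (private).
* §2 EVERY NON-SPLIT PLACE.  `norm_or_mul_norm_of_fixed_not_norm` (a fixed non-norm `c ∈ U_F` represents the other class: `s ∈ N ∨ c·s ∈ N` on `U_F` — ★ `norm_dichotomy_of_not_norm`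
  on `L_w`); `apply_mul_self_eq_one_of_fixed` (`χ₁(s·s) = 1`), `apply_eq_neg_one_of_fixed_of_ne_one` (`χ₁ s ≠ 1 ⇒ χ₁ s = −1`); **`apply_fixed_eq_one_iff_exists_norm`**
  (`hB`, `hFε` ⇒ for `s ∈ U_F`: `χ₁ s = 1 ↔ ∃ y : Rˣ, σy·y = s`); **`apply_fixed_eq_normSign`** (`(χ₁ s : ℂ) = normSign σ_w (s_w)` — «`χ₁|_{U_F} = ω|`», the junction with ★
  `WildQuadraticDatumNormSignConductor` whose `sum_normSign_repr_eq_zero` is the wild character sum); `apply_fixed_eq_of_letters` (two characters with both letters agree on `U_F`).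
* §3 AT A RAMIFIED PLACE (`he : e(w∣v) ≠ 1`; datum `hD : IsRamifiedQuadraticDatum σ_w ϖ d t`, ★ `exists_isRamifiedQuadraticDatum_of_placesOver`):
  **`exists_fixed_nonnorm_dichotomy_of_ramified`** (`[U_F : N(U_E)] = 2` ON THE NOSE in `Rˣ` letters: a fixed non-norm `c ∈ U_F` with `U_F = N ⊔ c⁻¹N`);
  **`apply_eq_one_of_fixed_of_valued_sub_one_le`** (`hB` ⇒ `χ₁ u = 1` for fixed `u` with `|u_w − 1| ≤ |ϖ|^n`, `n ≥ 2d − 1` — the wild twin of ★ (B-10)(1)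
  `RamFixedPrincipalUnits`: conductor `≤ d`); **`exists_fixed_near_one_apply_eq_neg_one`** (`hB`, `hFε` ⇒ a fixed `u ∈ U_F`, `|u_w − 1| ≤ |ϖ|^{2(d−1)}`, `χ₁ u = −1`: conductor
  `= d` EXACTLY — K2E3-p34 (c)'s «`a_F ∈ {0, d}`», p02 §4's «(R-b): `a_F = d`»).
HONEST LABEL.  HC_CM is proved only modulo the 7 printed citations (2 remaining named inputs: hLiu418 = `stmt-HodgeConjecture-24832`, h413 = `stmt-HodgeConjecture-24833`) until rung 0
closes; (W-2) is infrastructure of the (R-b)-wild determinant road and pays NO socket; (S-W) stays the XL residual of :182; REL ≠ ★ ≠ BUILT.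

## References
* [Serre1979] J.-P. Serre, *Local Fields*, GTM 67 (1979), Ch. V §3 Prop. 5 Cor. 2–3 pp. 85–87 (`U_K ∕ N U_L` of order `2`; its conductor), Ch. XIV §2, Ch. XV §2.
* [NeukirchANT1999] J. Neukirch, *Algebraic Number Theory*, Grundlehren 322 (1999), Ch. V (1.3) (the local norm index).
* [Rogawski1990] J. D. Rogawski, *Automorphic Representations of Unitary Groups in Three Variables*, Ann. of Math. Stud. 123 (1990), §4.8 p. 51 (`μ|_{F^×} = ω_{E∕F}`), §12.2 (2) p. 173.
* [Keys1984] D. Keys, *Principal series representations of special unitary groups over local fields*, Compositio Math. 51 (1984), §7 Theorem (2) (d) p. 126.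
-/

set_option autoImplicit false
-- the mandated namespace has the single-problem summit's repeated segment (`HodgeConjecture.HodgeConjecture`)
set_option linter.dupNamespace false

noncomputable section

open NumberField IsDedekindDomain
open scoped Valued
open Literature.NumberTheory.Automorphic Literature.NumberTheory.Automorphic.UnitaryGroup
open Literature.NumberTheory.Automorphic.UnitaryThreeFourFrame (IsRamifiedQuadraticDatum normSign normSign_of_isNorm normSign_of_not_isNorm)
open Literature.NumberTheory.LocalFields
open Summit.HodgeConjecture.HodgeConjecture.Cruxes.H413

namespace Summit.HodgeConjecture.HodgeConjecture.R90.S1.WildUnitNormIndex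

variable (L : Type) [Field L] [NumberField L] [IsCMField L] (v : HeightOneSpectrum (𝓞 ↥(maximalRealSubfield L)))
  (w : PlacesOver L v) (hw : IsCMField.complexConj L • w.1 = w.1)

/-! ## §1 Transport kit: `R = Π_{w′∣v} L_{w′}` has ONE factor at a non-split place -/

include hw in
/-- A unit of `R` is non-zero at `w` (one place above `v`). [cite: CasselsFrohlichANT1967, Ch. II §10] -/
private theorem apply_ne_zero (x : (LocalRing L v)ˣ) : (x : LocalRing L v) w ≠ 0 := fun h0 =>
  ((F0P3cStCharTSLocalRingNormDictionary.isUnit_iff_ne_zero_localRing L v w hw _).1 x.isUnit)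
    ((LocalRing.eq_iff_apply_eq (IsCMField.complexConj L) (IsCMField.complexConj_ne_one L) w hw _ 0).2 h0)

include hw in
/-- Lift of a non-zero element of `L_w` to a unit of `R` (adapted from the private twin in ★ `R90S1QuadraticCharOfNormTrivial`). [cite: CasselsFrohlichANT1967, Ch. II §10] -/
private theorem exists_unit_apply_eq {z : w.1.adicCompletion L} (hz : z ≠ 0) :
    ∃ y : (LocalRing L v)ˣ, (y : LocalRing L v) w = z := by
  classical
  set y₀ : LocalRing L v := Function.update 0 w z with hy₀
  have hy₀w : y₀ w = z := by rw [hy₀, Function.update_self]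
  have hne : y₀ ≠ 0 := fun h => hz (by rw [← hy₀w, h, Pi.zero_apply])
  have hu : IsUnit y₀ := (F0P3cStCharTSLocalRingNormDictionary.isUnit_iff_ne_zero_localRing L v w hw y₀).2 hne
  exact ⟨hu.unit, by rw [hu.unit_spec, hy₀w]⟩

include hw in
/-- The norm `σy·y` read at `w` is `y_w · σ_w(y_w)`. [cite: Serre1979, Ch. V §3] -/
private theorem norm_apply (y : (LocalRing L v)ˣ) :
    ((Units.map (conjLocal L (IsCMField.complexConj L) v : LocalRing L v →* LocalRing L v) y * y : (LocalRing L v)ˣ) : LocalRing L v) w =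
      (y : LocalRing L v) w * galAdicCompletionMap (L := L) (IsCMField.complexConj L) hw ((y : LocalRing L v) w) := by
  rw [Units.val_mul, Units.coe_map, MonoidHom.coe_coe, Pi.mul_apply,
    conjLocal_apply_eq_of_smul_eq (IsCMField.complexConj L) (IsCMField.complexConj_ne_one L) v w hw, mul_comm]

include hw in
/-- A `σ`-fixed unit of `R` is `σ_w`-fixed at `w`. [cite: Serre1979, Ch. V §3] -/
private theorem map_apply_of_fixed {x : (LocalRing L v)ˣ}
    (hx : Units.map (conjLocal L (IsCMField.complexConj L) v : LocalRing L v →* LocalRing L v) x = x) :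
    galAdicCompletionMap (L := L) (IsCMField.complexConj L) hw ((x : LocalRing L v) w) = (x : LocalRing L v) w := by
  have h := congrArg (fun u : (LocalRing L v)ˣ => (u : LocalRing L v) w) hx
  simpa only [Units.coe_map, MonoidHom.coe_coe, conjLocal_apply_eq_of_smul_eq (IsCMField.complexConj L) (IsCMField.complexConj_ne_one L) v w hw] using h

include hw in
/-- A norm `z·σ_w z = x_w` in `L_w` (`x` a unit of `R`) lifts to `σy·y = x` in `Rˣ`. [cite: Serre1979, Ch. V §3] -/
private theorem exists_norm_eq_of_apply (x : (LocalRing L v)ˣ) {z : w.1.adicCompletion L}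
    (hz : z * galAdicCompletionMap (L := L) (IsCMField.complexConj L) hw z = (x : LocalRing L v) w) :
    ∃ y : (LocalRing L v)ˣ, Units.map (conjLocal L (IsCMField.complexConj L) v : LocalRing L v →* LocalRing L v) y * y = x := by
  have hz0 : z ≠ 0 := by
    intro h0
    rw [h0, zero_mul] at hz
    exact apply_ne_zero L v w hw x hz.symm
  obtain ⟨y, hy⟩ := exists_unit_apply_eq L v w hw hz0
  refine ⟨y, Units.ext ((LocalRing.eq_iff_apply_eq (IsCMField.complexConj L) (IsCMField.complexConj_ne_one L) w hw _ _).2 ?_)⟩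
  rw [norm_apply L v w hw, hy, hz]

include hw in
/-- **`σy·y ∈ U_F ⇒ y` HAS MODULUS ONE**: if `σy·y = s` with `|s_{w′}| = 1` for every `w′ ∣ v`, then `|y_{w′}| = 1` (`|σy·y|_w = |y|_w²`; one place). [cite: Serre1979, Ch. V §3] -/
theorem valued_apply_eq_one_of_norm_eq {y s : (LocalRing L v)ˣ}
    (h : Units.map (conjLocal L (IsCMField.complexConj L) v : LocalRing L v →* LocalRing L v) y * y = s)
    (hs : ∀ w' : PlacesOver L v, Valued.v ((s : LocalRing L v) w') = 1) (w' : PlacesOver L v) : Valued.v ((y : LocalRing L v) w') = 1 := by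
  haveI : Algebra.IsQuadraticExtension ↥(maximalRealSubfield L) L := IsCMField.isQuadraticExtension L
  haveI : Subsingleton (PlacesOver L v) :=
    PlacesOver.subsingleton_of_smul_eq (IsCMField.complexConj L) (IsCMField.complexConj_ne_one L) w hw
  obtain rfl : w' = w := Subsingleton.elim _ _
  have hsq : Valued.v ((y : LocalRing L v) w') * Valued.v ((y : LocalRing L v) w') = 1 := by
    have e := congrArg (fun u : (LocalRing L v)ˣ => Valued.v ((u : LocalRing L v) w')) h
    simp only [norm_apply L v w' hw, map_mul, valued_galAdicCompletionMap] at e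
    rw [e]; exact hs w'
  have h0 : Valued.v ((y : LocalRing L v) w') ≠ 0 := fun h0 => by rw [h0, zero_mul] at hsq; exact zero_ne_one hsq
  obtain ⟨k, hk⟩ : ∃ k : ℤ, Valued.v ((y : LocalRing L v) w') = WithZero.exp k := ⟨_, (WithZero.exp_log h0).symm⟩
  rw [hk, ← WithZero.exp_add, ← WithZero.exp_zero, WithZero.exp_inj] at hsq
  rw [hk, ← WithZero.exp_zero]
  congr 1; omega

/-! ## §2 Every non-split place: the dichotomy with a fixed non-norm unit, and `χ₁|_{U_F} = ω|` -/

include hw in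
/-- **A FIXED NON-NORM UNIT REPRESENTS THE OTHER CLASS**: if `c ∈ U_F` is not a norm `σy·y` (`y ∈ Rˣ`), then every `s ∈ U_F` is a norm `σy·y` or `c·s` is — ★
`LocalFieldInvolutionNorm.norm_dichotomy_of_not_norm` on the local field `L_w` with the involution `σ_w`, transported along the one-place dictionary.
[cite: Serre1979, Ch. V §3 Prop. 5 Cor. 3; Ch. XIV §2] [cite: NeukirchANT1999, Ch. V (1.3)] -/
theorem norm_or_mul_norm_of_fixed_not_norm {c : (LocalRing L v)ˣ}
    (hσc : Units.map (conjLocal L (IsCMField.complexConj L) v : LocalRing L v →* LocalRing L v) c = c)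
    (hcn : ∀ y : (LocalRing L v)ˣ, Units.map (conjLocal L (IsCMField.complexConj L) v : LocalRing L v →* LocalRing L v) y * y ≠ c)
    {s : (LocalRing L v)ˣ} (hσs : Units.map (conjLocal L (IsCMField.complexConj L) v : LocalRing L v →* LocalRing L v) s = s) :
    (∃ y : (LocalRing L v)ˣ, Units.map (conjLocal L (IsCMField.complexConj L) v : LocalRing L v →* LocalRing L v) y * y = s) ∨
      ∃ y : (LocalRing L v)ˣ, Units.map (conjLocal L (IsCMField.complexConj L) v : LocalRing L v →* LocalRing L v) y * y = c * s := by
  classical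
  haveI : CharZero (w.1.adicCompletion L) := charZero_of_injective_algebraMap (algebraMap L (w.1.adicCompletion L)).injective
  have hc1 : IsCMField.complexConj L ≠ 1 := IsCMField.complexConj_ne_one L
  -- the local involution `σ_w`: square one, not the identity
  have hσσ : ∀ z : w.1.adicCompletion L, galAdicCompletionMap (L := L) (IsCMField.complexConj L) hw
      (galAdicCompletionMap (L := L) (IsCMField.complexConj L) hw z) = z :=
    fun z => galAdicCompletionMap_galAdicCompletionMap_of_smul_eq (IsCMField.complexConj L) w hc1 hw z
  have hσ1 : galAdicCompletionMap (L := L) (IsCMField.complexConj L) hw ≠ RingHom.id (w.1.adicCompletion L) := by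
    intro hid
    obtain ⟨δ, hδ⟩ := exists_conjLocal_skew_unit L v
    have e := congrArg (fun t : LocalRing L v => t w) hδ
    simp only [conjLocal_apply_eq_of_smul_eq (IsCMField.complexConj L) hc1 v w hw, hid, RingHom.id_apply, Pi.neg_apply] at e
    exact apply_ne_zero L v w hw δ (by linear_combination e / 2)
  -- `c_w` is a fixed non-norm of `L_w`
  have hcn' : ∀ z : w.1.adicCompletion L, z * galAdicCompletionMap (L := L) (IsCMField.complexConj L) hw z ≠ (c : LocalRing L v) w := by
    intro z hz
    obtain ⟨y, hy⟩ := exists_norm_eq_of_apply L v w hw c hz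
    exact hcn y hy
  rcases LocalFieldInvolutionNorm.norm_dichotomy_of_not_norm _ hσσ hσ1 (map_apply_of_fixed L v w hw hσc) (apply_ne_zero L v w hw c) hcn'
      (map_apply_of_fixed L v w hw hσs) (apply_ne_zero L v w hw s) with ⟨z, hz⟩ | ⟨z, hz⟩
  · exact Or.inl (exists_norm_eq_of_apply L v w hw s hz)
  · have hz' : z * galAdicCompletionMap (L := L) (IsCMField.complexConj L) hw z = ((c * s : (LocalRing L v)ˣ) : LocalRing L v) w := by
      rw [hz, Units.val_mul, Pi.mul_apply]
    exact Or.inr (exists_norm_eq_of_apply L v w hw (c * s) hz')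

/-- **`χ₁(s·s) = 1` ON `U_F`** from `hB` alone (`s·σs = s·s` for a fixed `s`). [cite: Keys1984, §7 Theorem (2) (d) p. 126] [cite: Rogawski1990, §12.2 (2) p. 173] -/
theorem apply_mul_self_eq_one_of_fixed (χ₁ : (LocalRing L v)ˣ →* ℂˣ)
    (hB : ∀ u : (LocalRing L v)ˣ, (∀ w' : PlacesOver L v, Valued.v ((u : LocalRing L v) w') = 1) →
      χ₁ (u * Units.map (conjLocal L (IsCMField.complexConj L) v : LocalRing L v →* LocalRing L v) u) = 1)
    {s : (LocalRing L v)ˣ} (hσs : Units.map (conjLocal L (IsCMField.complexConj L) v : LocalRing L v →* LocalRing L v) s = s)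
    (hs : ∀ w' : PlacesOver L v, Valued.v ((s : LocalRing L v) w') = 1) : χ₁ (s * s) = 1 := by
  have h := hB s hs
  rwa [hσs] at h

/-- **`χ₁ s = ±1` ON `U_F`** (`hB`): `(χ₁ s)² = χ₁(s·s) = 1` in `ℂ`. [cite: Keys1984, §7 Theorem (2) (d) p. 126] [cite: Rogawski1990, §12.2 (2) p. 173] -/
theorem apply_eq_one_or_eq_neg_one_of_fixed (χ₁ : (LocalRing L v)ˣ →* ℂˣ)
    (hB : ∀ u : (LocalRing L v)ˣ, (∀ w' : PlacesOver L v, Valued.v ((u : LocalRing L v) w') = 1) →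
      χ₁ (u * Units.map (conjLocal L (IsCMField.complexConj L) v : LocalRing L v →* LocalRing L v) u) = 1)
    {s : (LocalRing L v)ˣ} (hσs : Units.map (conjLocal L (IsCMField.complexConj L) v : LocalRing L v →* LocalRing L v) s = s)
    (hs : ∀ w' : PlacesOver L v, Valued.v ((s : LocalRing L v) w') = 1) :
    ((χ₁ s : ℂˣ) : ℂ) = 1 ∨ ((χ₁ s : ℂˣ) : ℂ) = -1 := by
  have h := apply_mul_self_eq_one_of_fixed L v χ₁ hB hσs hs
  rw [map_mul] at h
  have h' : ((χ₁ s : ℂˣ) : ℂ) * ((χ₁ s : ℂˣ) : ℂ) = 1 := by rw [← Units.val_mul, h, Units.val_one]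
  exact mul_self_eq_one_iff.1 h'

/-- **`χ₁ s ≠ 1 ⇒ χ₁ s = −1` ON `U_F`** (`hB`).  In particular the letter unit `a₀` of `hFε` has `χ₁ a₀ = −1`. [cite: Keys1984, §7 Theorem (2) (d) p. 126] [cite: Rogawski1990, §12.2 (2) p. 173] -/
theorem apply_eq_neg_one_of_fixed_of_ne_one (χ₁ : (LocalRing L v)ˣ →* ℂˣ)
    (hB : ∀ u : (LocalRing L v)ˣ, (∀ w' : PlacesOver L v, Valued.v ((u : LocalRing L v) w') = 1) →
      χ₁ (u * Units.map (conjLocal L (IsCMField.complexConj L) v : LocalRing L v →* LocalRing L v) u) = 1)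
    {s : (LocalRing L v)ˣ} (hσs : Units.map (conjLocal L (IsCMField.complexConj L) v : LocalRing L v →* LocalRing L v) s = s)
    (hs : ∀ w' : PlacesOver L v, Valued.v ((s : LocalRing L v) w') = 1) (hne : χ₁ s ≠ 1) : ((χ₁ s : ℂˣ) : ℂ) = -1 :=
  (apply_eq_one_or_eq_neg_one_of_fixed L v χ₁ hB hσs hs).resolve_left fun h => hne (Units.val_eq_one.1 h)

include hw in
/-- **`χ₁ s = 1 ↔ s ∈ N(Rˣ)` ON `U_F`**, for `χ₁` killing the unit norms (`hB`) and non-trivial on `U_F` (`hFε`): the letter unit `a₀` is a fixed non-norm (a norm is killed by `hB`), so by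
★ `norm_or_mul_norm_of_fixed_not_norm` a fixed `s` with `χ₁ s = 1` that is not a norm would have `a₀·s ∈ N`, forcing `χ₁ a₀ = 1`.  This is `IsQuadraticCharExtension` CUT DOWN TO THE UNITS
(★ `isQuadraticCharExtension_of_forall_norm_of_exists_fixed` needs `χ₁` to kill ALL norms, which `hB` does not give before the root `hroot` is known).
[cite: Serre1979, Ch. V §3 Prop. 5 Cor. 3; Ch. XIV §2] [cite: Rogawski1990, §4.8 p. 51; §12.2 (2) p. 173] [cite: Keys1984, §7 Theorem (2) (d) p. 126] -/
theorem apply_fixed_eq_one_iff_exists_norm (χ₁ : (LocalRing L v)ˣ →* ℂˣ)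
    (hB : ∀ u : (LocalRing L v)ˣ, (∀ w' : PlacesOver L v, Valued.v ((u : LocalRing L v) w') = 1) →
      χ₁ (u * Units.map (conjLocal L (IsCMField.complexConj L) v : LocalRing L v →* LocalRing L v) u) = 1)
    (hFε : ∃ a : (LocalRing L v)ˣ, Units.map (conjLocal L (IsCMField.complexConj L) v : LocalRing L v →* LocalRing L v) a = a ∧
      (∀ w' : PlacesOver L v, Valued.v ((a : LocalRing L v) w') = 1) ∧ χ₁ a ≠ 1)
    {s : (LocalRing L v)ˣ} (hσs : Units.map (conjLocal L (IsCMField.complexConj L) v : LocalRing L v →* LocalRing L v) s = s)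
    (hs : ∀ w' : PlacesOver L v, Valued.v ((s : LocalRing L v) w') = 1) :
    χ₁ s = 1 ↔ ∃ y : (LocalRing L v)ˣ, Units.map (conjLocal L (IsCMField.complexConj L) v : LocalRing L v →* LocalRing L v) y * y = s := by
  -- `hB` kills every unit norm landing in `U_F`
  have hkill : ∀ (y x : (LocalRing L v)ˣ), Units.map (conjLocal L (IsCMField.complexConj L) v : LocalRing L v →* LocalRing L v) y * y = x →
      (∀ w' : PlacesOver L v, Valued.v ((x : LocalRing L v) w') = 1) → χ₁ x = 1 := by
    intro y x hy hx
    rw [← hy, mul_comm]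
    exact hB y (valued_apply_eq_one_of_norm_eq L v w hw hy hx)
  obtain ⟨a₀, ha₀σ, ha₀1, hχa₀⟩ := hFε
  have ha₀n : ∀ y : (LocalRing L v)ˣ, Units.map (conjLocal L (IsCMField.complexConj L) v : LocalRing L v →* LocalRing L v) y * y ≠ a₀ :=
    fun y hy => hχa₀ (hkill y a₀ hy ha₀1)
  refine ⟨fun hχs => ?_, fun ⟨y, hy⟩ => hkill y s hy hs⟩
  rcases norm_or_mul_norm_of_fixed_not_norm L v w hw ha₀σ ha₀n hσs with h | ⟨y, hy⟩
  · exact h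
  · exfalso
    have h1 : χ₁ (a₀ * s) = 1 :=
      hkill y (a₀ * s) hy fun w' => by rw [Units.val_mul, Pi.mul_apply, map_mul, ha₀1 w', hs w', mul_one]
    rw [map_mul, hχs, mul_one] at h1
    exact hχa₀ h1

include hw in
/-- **`χ₁|_{U_F} = ω|` — THE JUNCTION WITH THE NORM-CLASS SIGN**: for `χ₁` with `hB` and `hFε` and every `s ∈ U_F`, `(χ₁ s : ℂ) = normSign σ_w (s_w)` (★ def H1 `normSign σ x = +1` iff
`x = z·σz`, else `−1`; a norm at `w` lifts to a unit norm in `R`).  Through this identity the ★ conductor-`d` toolkit and the character sums ★ `sum_normSign_repr_eq_zero` of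
`WildQuadraticDatumNormSignConductor` apply to `χ₁` verbatim. [cite: Serre1979, Ch. V §3 Prop. 5 Cor. 3; Ch. XV §2] [cite: Rogawski1990, §4.8 p. 51; §4.9 p. 55; §12.2 (2) p. 173] -/
theorem apply_fixed_eq_normSign (χ₁ : (LocalRing L v)ˣ →* ℂˣ)
    (hB : ∀ u : (LocalRing L v)ˣ, (∀ w' : PlacesOver L v, Valued.v ((u : LocalRing L v) w') = 1) →
      χ₁ (u * Units.map (conjLocal L (IsCMField.complexConj L) v : LocalRing L v →* LocalRing L v) u) = 1)
    (hFε : ∃ a : (LocalRing L v)ˣ, Units.map (conjLocal L (IsCMField.complexConj L) v : LocalRing L v →* LocalRing L v) a = a ∧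
      (∀ w' : PlacesOver L v, Valued.v ((a : LocalRing L v) w') = 1) ∧ χ₁ a ≠ 1)
    {s : (LocalRing L v)ˣ} (hσs : Units.map (conjLocal L (IsCMField.complexConj L) v : LocalRing L v →* LocalRing L v) s = s)
    (hs : ∀ w' : PlacesOver L v, Valued.v ((s : LocalRing L v) w') = 1) :
    ((χ₁ s : ℂˣ) : ℂ) = ((normSign (galAdicCompletionMap (L := L) (IsCMField.complexConj L) hw) ((s : LocalRing L v) w) : ℤ) : ℂ) := by
  by_cases hn : ∃ z : w.1.adicCompletion L, z * galAdicCompletionMap (L := L) (IsCMField.complexConj L) hw z = (s : LocalRing L v) w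
  · obtain ⟨z, hz⟩ := hn
    have h1 : χ₁ s = 1 := (apply_fixed_eq_one_iff_exists_norm L v w hw χ₁ hB hFε hσs hs).2 (exists_norm_eq_of_apply L v w hw s hz)
    rw [normSign_of_isNorm _ ⟨z, hz⟩, h1, Units.val_one, Int.cast_one]
  · have hne : χ₁ s ≠ 1 := fun h1 => by
      obtain ⟨y, hy⟩ := (apply_fixed_eq_one_iff_exists_norm L v w hw χ₁ hB hFε hσs hs).1 h1
      exact hn ⟨(y : LocalRing L v) w, by rw [← norm_apply L v w hw, hy]⟩
    rw [normSign_of_not_isNorm _ hn, apply_eq_neg_one_of_fixed_of_ne_one L v χ₁ hB hσs hs hne, Int.cast_neg, Int.cast_one]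

include hw in
/-- **UNIQUENESS ON `U_F`**: two characters of `Rˣ` killing the unit norms and non-trivial on `U_F` AGREE on `U_F` (both are `normSign σ_w`) — «a character of `𝒪_F^×` trivial on `N(𝒪_E^×)`
and `≠ 1` is unique», i.e. `[U_F : N U_E] ≤ 2` in character form. [cite: Serre1979, Ch. V §3 Prop. 5 Cor. 3] [cite: Rogawski1990, §4.8 p. 51] -/
theorem apply_fixed_eq_of_letters (χ₁ χ₂ : (LocalRing L v)ˣ →* ℂˣ)
    (hB₁ : ∀ u : (LocalRing L v)ˣ, (∀ w' : PlacesOver L v, Valued.v ((u : LocalRing L v) w') = 1) →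
      χ₁ (u * Units.map (conjLocal L (IsCMField.complexConj L) v : LocalRing L v →* LocalRing L v) u) = 1)
    (hFε₁ : ∃ a : (LocalRing L v)ˣ, Units.map (conjLocal L (IsCMField.complexConj L) v : LocalRing L v →* LocalRing L v) a = a ∧
      (∀ w' : PlacesOver L v, Valued.v ((a : LocalRing L v) w') = 1) ∧ χ₁ a ≠ 1)
    (hB₂ : ∀ u : (LocalRing L v)ˣ, (∀ w' : PlacesOver L v, Valued.v ((u : LocalRing L v) w') = 1) →
      χ₂ (u * Units.map (conjLocal L (IsCMField.complexConj L) v : LocalRing L v →* LocalRing L v) u) = 1)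
    (hFε₂ : ∃ a : (LocalRing L v)ˣ, Units.map (conjLocal L (IsCMField.complexConj L) v : LocalRing L v →* LocalRing L v) a = a ∧
      (∀ w' : PlacesOver L v, Valued.v ((a : LocalRing L v) w') = 1) ∧ χ₂ a ≠ 1)
    {s : (LocalRing L v)ˣ} (hσs : Units.map (conjLocal L (IsCMField.complexConj L) v : LocalRing L v →* LocalRing L v) s = s)
    (hs : ∀ w' : PlacesOver L v, Valued.v ((s : LocalRing L v) w') = 1) : χ₁ s = χ₂ s :=
  Units.ext (by rw [apply_fixed_eq_normSign L v w hw χ₁ hB₁ hFε₁ hσs hs, apply_fixed_eq_normSign L v w hw χ₂ hB₂ hFε₂ hσs hs])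

/-! ## §3 At a RAMIFIED place: index EXACTLY two on `U_F`, and the conductor `d` of `χ₁|_{U_F}` -/

include hw in
/-- **`[U_F : N U_E] = 2` ON THE NOSE, IN `Rˣ` LETTERS**, at a RAMIFIED non-split place (`e(w∣v) ≠ 1`; tame OR wild): there is a `σ`-fixed unit `c ∈ U_F` which is NOT a norm `σy·y`
(`y ∈ Rˣ`), and every `s ∈ U_F` is a norm or `c·s` is — ★ `UnitaryGroup.exists_unit_fixed_nonnorm` on the datum ★ `exists_isRamifiedQuadraticDatum_of_placesOver` (Serre V §3 Cor. 3
for `ℓ = 2`, incl. the dyadic induction, by the FOUR-FRAME squad), lifted along §1. [cite: Serre1979, Ch. V §3 Prop. 5 Cor. 3] [cite: NeukirchANT1999, Ch. V (1.3)] -/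
theorem exists_fixed_nonnorm_dichotomy_of_ramified (he : v.asIdeal.ramificationIdx' w.1.asIdeal ≠ 1) :
    ∃ c : (LocalRing L v)ˣ, Units.map (conjLocal L (IsCMField.complexConj L) v : LocalRing L v →* LocalRing L v) c = c ∧
      (∀ w' : PlacesOver L v, Valued.v ((c : LocalRing L v) w') = 1) ∧
      (∀ y : (LocalRing L v)ˣ, Units.map (conjLocal L (IsCMField.complexConj L) v : LocalRing L v →* LocalRing L v) y * y ≠ c) ∧
      ∀ s : (LocalRing L v)ˣ, Units.map (conjLocal L (IsCMField.complexConj L) v : LocalRing L v →* LocalRing L v) s = s →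
        (∀ w' : PlacesOver L v, Valued.v ((s : LocalRing L v) w') = 1) →
        (∃ y : (LocalRing L v)ˣ, Units.map (conjLocal L (IsCMField.complexConj L) v : LocalRing L v →* LocalRing L v) y * y = s) ∨
          ∃ y : (LocalRing L v)ˣ, Units.map (conjLocal L (IsCMField.complexConj L) v : LocalRing L v →* LocalRing L v) y * y = c * s := by
  haveI : Algebra.IsQuadraticExtension ↥(maximalRealSubfield L) L := IsCMField.isQuadraticExtension L
  haveI : Subsingleton (PlacesOver L v) :=
    PlacesOver.subsingleton_of_smul_eq (IsCMField.complexConj L) (IsCMField.complexConj_ne_one L) w hw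
  obtain ⟨π, hπ⟩ := exists_unit_valued_apply_eq_exp_neg_one L v w
  obtain ⟨d, t, hD⟩ := F0P3cDyRamWildPlaceDatum.exists_isRamifiedQuadraticDatum_of_placesOver L w hw he _ hπ
  obtain ⟨ε, hεσ, hε1, hεn, -⟩ := exists_unit_fixed_nonnorm L v w hw hD
  have hεσ' : Units.map (conjLocal L (IsCMField.complexConj L) v : LocalRing L v →* LocalRing L v) ε = ε :=
    Units.ext (by rw [Units.coe_map, MonoidHom.coe_coe]; exact hεσ)
  have hεn' : ∀ y : (LocalRing L v)ˣ, Units.map (conjLocal L (IsCMField.complexConj L) v : LocalRing L v →* LocalRing L v) y * y ≠ ε := by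
    intro y hy
    exact hεn ⟨(y : LocalRing L v) w, by rw [← norm_apply L v w hw, hy]⟩
  refine ⟨ε, hεσ', fun w' => ?_, hεn', fun s hσs _ => norm_or_mul_norm_of_fixed_not_norm L v w hw hεσ' hεn' hσs⟩
  obtain rfl : w' = w := Subsingleton.elim _ _
  exact hε1

include hw in
/-- **CONDUCTOR `≤ d`: `hB ⇒ χ₁ u = 1` FOR EVERY FIXED UNIT `u ≡ 1 (mod ϖ_w^n)`, `n ≥ 2d − 1`** (`d` the different exponent of the place datum `hD`): such a `u` is a norm `z·σ_w z` in `L_w`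
(★ `WildQuadraticDatum.exists_mul_map_eq_of_fixed_of_v_sub_one_le_pred`, Serre V §3 Cor. 3: `N(U_E^{(2d−1+·)}) ⊇ U_F^{(d)}`), which lifts to a unit norm `σy·y = u` of modulus one,
killed by `hB`.  The WILD TWIN of ★ (B-10)(1) `R90S1BposRamFixedPrincipalUnits.apply_eq_one_of_branchB_of_fixed_principal_ram` (there `d = 1`, `h2w`, Hensel squares).
[cite: Serre1979, Ch. V §3 Prop. 5 Cor. 2–3 pp. 85–87; Ch. XV §2] [cite: Rogawski1990, §12.2 (2) p. 173] -/
theorem apply_eq_one_of_fixed_of_valued_sub_one_le (χ₁ : (LocalRing L v)ˣ →* ℂˣ)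
    (hB : ∀ u : (LocalRing L v)ˣ, (∀ w' : PlacesOver L v, Valued.v ((u : LocalRing L v) w') = 1) →
      χ₁ (u * Units.map (conjLocal L (IsCMField.complexConj L) v : LocalRing L v →* LocalRing L v) u) = 1)
    {ϖ : w.1.adicCompletion L} {d t : ℕ} (hD : IsRamifiedQuadraticDatum (galAdicCompletionMap (L := L) (IsCMField.complexConj L) hw) ϖ d t)
    {u : (LocalRing L v)ˣ} (hσu : Units.map (conjLocal L (IsCMField.complexConj L) v : LocalRing L v →* LocalRing L v) u = u)
    {n : ℕ} (hn : 2 * d - 1 ≤ n) (hu : Valued.v ((u : LocalRing L v) w - 1) ≤ Valued.v ϖ ^ n) : χ₁ u = 1 := by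
  haveI : Algebra.IsQuadraticExtension ↥(maximalRealSubfield L) L := IsCMField.isQuadraticExtension L
  haveI : Subsingleton (PlacesOver L v) :=
    PlacesOver.subsingleton_of_smul_eq (IsCMField.complexConj L) (IsCMField.complexConj_ne_one L) w hw
  have hϖ : Valued.v ϖ = WithZero.exp (-1 : ℤ) := hD.2.2.1
  have hd1 : 1 ≤ d := hD.2.2.2.2.2.1
  obtain ⟨z, hz⟩ := WildQuadraticDatum.exists_mul_map_eq_of_fixed_of_v_sub_one_le_pred hD (map_apply_of_fixed L v w hw hσu) hn hu
  obtain ⟨y, hy⟩ := exists_norm_eq_of_apply L v w hw u hz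
  -- `u` has modulus one: `|u_w − 1| ≤ |ϖ|^n < 1`
  have hlt : Valued.v ((u : LocalRing L v) w - 1) < 1 := by
    refine lt_of_le_of_lt hu ?_
    rw [WildQuadraticDatum.v_varpi_pow hϖ n, ← WithZero.exp_zero, WithZero.exp_lt_exp]
    omega
  have hu1 : ∀ w' : PlacesOver L v, Valued.v ((u : LocalRing L v) w') = 1 := by
    intro w'
    obtain rfl : w' = w := Subsingleton.elim _ _
    have e : (u : LocalRing L v) w' = 1 + ((u : LocalRing L v) w' - 1) := by ring
    rw [e]
    exact Valuation.map_one_add_of_lt _ hlt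
  rw [← hy, mul_comm]
  exact hB y (valued_apply_eq_one_of_norm_eq L v w hw hy hu1)

include hw in
/-- **CONDUCTOR `= d` EXACTLY: `hB`, `hFε ⇒` A FIXED UNIT `u ≡ 1 (mod ϖ_w^{2(d−1)})` WITH `χ₁ u = −1`.**  At a WILD place (`t ≥ 1`, `|2|_w < 1`) ★
`WildQuadraticDatum.exists_fixed_unit_not_norm_v_sub_one_le` gives a fixed non-norm unit of `L_w` at the break level `2(d−1)`; at a TAME place (`t = 0`) `d = 1` (★ `d_le_succ_t`) and any
fixed non-norm unit (★ `exists_fixed_unit_not_norm_of_isRamifiedQuadraticDatum`) will do.  Lifted to `Rˣ` it is not a unit norm, so `χ₁ ≠ 1` there (§2 `apply_fixed_eq_one_iff_exists_norm`),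
hence `= −1`.  With `apply_eq_one_of_fixed_of_valued_sub_one_le`: the conductor of `χ₁|_{U_F}` is EXACTLY `d` in `F`-units (`a_F = d`).
[cite: Serre1979, Ch. V §3 Prop. 5 Cor. 2–3 pp. 85–87; Ch. XV §2] [cite: Rogawski1990, §12.2 (2) p. 173] [cite: Keys1984, §7 Theorem (2) (d) p. 126] -/
theorem exists_fixed_near_one_apply_eq_neg_one (χ₁ : (LocalRing L v)ˣ →* ℂˣ)
    (hB : ∀ u : (LocalRing L v)ˣ, (∀ w' : PlacesOver L v, Valued.v ((u : LocalRing L v) w') = 1) →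
      χ₁ (u * Units.map (conjLocal L (IsCMField.complexConj L) v : LocalRing L v →* LocalRing L v) u) = 1)
    (hFε : ∃ a : (LocalRing L v)ˣ, Units.map (conjLocal L (IsCMField.complexConj L) v : LocalRing L v →* LocalRing L v) a = a ∧
      (∀ w' : PlacesOver L v, Valued.v ((a : LocalRing L v) w') = 1) ∧ χ₁ a ≠ 1)
    {ϖ : w.1.adicCompletion L} {d t : ℕ} (hD : IsRamifiedQuadraticDatum (galAdicCompletionMap (L := L) (IsCMField.complexConj L) hw) ϖ d t) :
    ∃ u : (LocalRing L v)ˣ, Units.map (conjLocal L (IsCMField.complexConj L) v : LocalRing L v →* LocalRing L v) u = u ∧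
      (∀ w' : PlacesOver L v, Valued.v ((u : LocalRing L v) w') = 1) ∧
      Valued.v ((u : LocalRing L v) w - 1) ≤ Valued.v ϖ ^ (2 * (d - 1)) ∧ ((χ₁ u : ℂˣ) : ℂ) = -1 := by
  haveI : Algebra.IsQuadraticExtension ↥(maximalRealSubfield L) L := IsCMField.isQuadraticExtension L
  haveI : Subsingleton (PlacesOver L v) :=
    PlacesOver.subsingleton_of_smul_eq (IsCMField.complexConj L) (IsCMField.complexConj_ne_one L) w hw
  have hϖ : Valued.v ϖ = WithZero.exp (-1 : ℤ) := hD.2.2.1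
  haveI := isAdicComplete_valuedInteger_of_completeSpace hϖ
  haveI : Finite 𝓀[w.1.adicCompletion L] := finite_residueField_adicCompletion L w.1
  -- a fixed non-norm unit `c` of `L_w` at the break level `2(d−1)` (wild), resp. any level (tame, `d = 1`)
  obtain ⟨c, hσc, hc1, hcl, hcn⟩ : ∃ c : w.1.adicCompletion L, galAdicCompletionMap (L := L) (IsCMField.complexConj L) hw c = c ∧ Valued.v c = 1 ∧
      Valued.v (c - 1) ≤ Valued.v ϖ ^ (2 * (d - 1)) ∧ ¬ ∃ z : w.1.adicCompletion L, z * galAdicCompletionMap (L := L) (IsCMField.complexConj L) hw z = c := by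
    rcases Nat.eq_zero_or_pos t with ht0 | htpos
    · -- tame: `d = 1`
      have hd : d = 1 := le_antisymm (by have h := WildQuadraticDatum.d_le_succ_t hD.1 hD.2.2.2.1 hϖ hD.2.2.2.2.1 hD.2.2.2.2.2.2; omega) hD.2.2.2.2.2.1
      obtain ⟨c, hσc, hc1, hcn⟩ := WildQuadraticDatum.exists_fixed_unit_not_norm_of_isRamifiedQuadraticDatum _ ϖ d t hD
      refine ⟨c, hσc, hc1, ?_, hcn⟩
      rw [hd]
      simpa using (Valuation.map_sub _ c 1).trans (max_le hc1.le (by rw [map_one]))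
    · -- wild: `|2|_w = |ϖ|^t < 1`
      have h2v : Valued.v (2 : w.1.adicCompletion L) < 1 := by
        rw [hD.2.2.2.2.2.2, WildQuadraticDatum.v_varpi_pow hϖ t, ← WithZero.exp_zero, WithZero.exp_lt_exp]
        omega
      obtain ⟨c, hσc, hc1, hcl, hcn⟩ := WildQuadraticDatum.exists_fixed_unit_not_norm_v_sub_one_le hD h2v
      refine ⟨c, hσc, hc1, ?_, hcn⟩
      rw [WildQuadraticDatum.v_varpi_pow hϖ]
      refine hcl.trans (le_of_eq ?_)
      push_cast; rfl
  -- lift `c` to a `σ`-fixed unit `u ∈ U_F`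
  have hc0 : c ≠ 0 := fun h0 => by rw [h0, map_zero] at hc1; exact zero_ne_one hc1
  obtain ⟨u, hu⟩ := exists_unit_apply_eq L v w hw hc0
  have hσu : Units.map (conjLocal L (IsCMField.complexConj L) v : LocalRing L v →* LocalRing L v) u = u := by
    refine Units.ext ((LocalRing.eq_iff_apply_eq (IsCMField.complexConj L) (IsCMField.complexConj_ne_one L) w hw _ _).2 ?_)
    rw [Units.coe_map, MonoidHom.coe_coe, conjLocal_apply_eq_of_smul_eq (IsCMField.complexConj L) (IsCMField.complexConj_ne_one L) v w hw, hu, hσc]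
  have hu1 : ∀ w' : PlacesOver L v, Valued.v ((u : LocalRing L v) w') = 1 := by
    intro w'
    obtain rfl : w' = w := Subsingleton.elim _ _
    rw [hu]; exact hc1
  have hne : χ₁ u ≠ 1 := fun h1 => by
    obtain ⟨y, hy⟩ := (apply_fixed_eq_one_iff_exists_norm L v w hw χ₁ hB hFε hσu hu1).1 h1
    exact hcn ⟨(y : LocalRing L v) w, by rw [← norm_apply L v w hw, hy, hu]⟩
  exact ⟨u, hσu, hu1, by rw [hu]; exact hcl, apply_eq_neg_one_of_fixed_of_ne_one L v χ₁ hB hσu hu1 hne⟩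

end Summit.HodgeConjecture.HodgeConjecture.R90.S1.WildUnitNormIndex

end
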